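import Literature.AlgebraicGeometry.HodgeTheory.HodgeTypePullback
import Literature.AlgebraicGeometry.HodgeTheory.CupPreservesHodgeTypeOfDeRham
import Literature.AlgebraicGeometry.HodgeTheory.HodgeFiltrationModelsReductionProofs
import Literature.AlgebraicGeometry.HodgeTheory.ComplexConjugationHolds
import Literature.AlgebraicGeometry.HodgeTheory.WeilClassesFourfoldsProofs
import Literature.AlgebraicGeometry.Motives.AbelianVarietyProjectiveChart
import Literature.NumberTheory.Transcendental.DeRhamTheoremMultiplicative
import HarnessLib

/-!
# Route HeckePrymWeil · crux `WeilTenfoldsSqrtMinus11` (stmt-HodgeConjecture-1262) · line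
# `generic-ppav-secant-descent` · stub `stub_hodgeTypeExterior` (S5) — CLOSED, unconditional

Künneth compatibility of Hodge types on a product of complex abelian varieties (Voisin I,
Thm. 11.38): the exterior product `pr_A^* c ⌣ pr_B^* w` of a class of Hodge type `(p, q)` on `A` and
one of type `(p', q')` on `B` is of Hodge type `(p + p', q + q')` on `A × B` (dimension parameter
`a + b`). Wave-1 of this line reduced the registered stub to the multiplicative de Rham theorem
(`StubHodgeTypeExterior.BLOCKED.md`; Literature `HodgeTypeExteriorProduct`, p89709); that theorem
landed the same morning (`Literature.NumberTheory.Transcendental.exists_deRhamIsoFamily_holds`,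
`DeRhamTheoremMultiplicative.lean`), so the stub now closes with no named fact: pull-backs preserve
Hodge types (`nonempty_hodgeModel_holds`, `hodgePQ_independent_of_hodgeModel_holds`), and the cup
product adds Hodge types on `A × B` (`cupPreservesHodgeType_of_nonempty_hodgeModel` fed de Rham).
VERBATIM the registered stub (also verbatim the sibling crux stmt-HodgeConjecture-1260's
`hyperbolic-eightfold-descent` stub of the same name — one proof closes both).
-/

noncomputable section

-- single-problem summit (Problem = Summit): the mandated namespace repeats `HodgeConjecture`.
set_option linter.dupNamespace false

open scoped Manifold
open CategoryTheory Complex Literature.AlgebraicGeometry Literature.AlgebraicGeometry.Motives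
  Literature.AlgebraicGeometry.HodgeTheory Literature.AlgebraicTopology.SingularHomology

namespace Summit.HodgeConjecture.HodgeConjecture.Theorems.HeckePrymWeil

/-- **De Rham's theorem, multiplicative form, for complex model spaces** (the shape consumed by
`cupPreservesHodgeType_of_nonempty_hodgeModel`): for every finite-dimensional complex normed space
`E` (viewed as a real one), the integration de Rham family on manifolds charted on `E` is natural,
multiplicative and normalised — the tree's `exists_deRhamIsoFamily_holds` (Warner GTM 94, 5.36/5.45). -/
theorem multiplicativeDeRham_complexModel :
    ∀ (E : Type) [NormedAddCommGroup E] [NormedSpace ℂ E] [FiniteDimensional ℂ E],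
      Literature.NumberTheory.Transcendental.exists_deRhamIsoFamily 𝓘(ℝ, E) :=
  fun E _ _ _ => Literature.NumberTheory.Transcendental.exists_deRhamIsoFamily_holds E

/-- **Stub S5 `stub_hodgeTypeExterior`, CLOSED** (Voisin I Thm. 11.38 on the tree's real carriers):
Hodge types add under exterior products on `A × B`. Proof: `IsOfHodgeType` is independent of the
Hodge model (`hodgePQ_independent_of_hodgeModel_holds`) and models exist (`nonempty_hodgeModel_holds`),
so `pr_A^*`, `pr_B^*` preserve Hodge types (`preservesHodgeType_of_nonempty_hodgeModel`); the cup product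
respects the bigrading on the smooth projective `A × B` (`cupPreservesHodgeType_of_nonempty_hodgeModel`,
fed the multiplicative de Rham theorem `multiplicativeDeRham_complexModel`); assemble with
`isOfHodgeType_cupProduct_map_fst_map_snd`. -/
theorem stub_hodgeTypeExterior :
    ∀ (A B : AbelianVariety ℂ) (a b : ℕ), A.dim = a → B.dim = b →
    ∀ (k l m : ℕ) (hklm : k + l = m) (p q p' q' : ℕ)
      (c : complexBetti A.X k) (w : complexBetti B.X l),
      IsOfHodgeType a A.X k p q c → IsOfHodgeType b B.X l p' q' w →
      IsOfHodgeType (a + b) (A.prod B).X m (p + p') (q + q')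
        (cupProduct hklm (complexBetti.map (AbelianVariety.fst A B).hom.hom.hom k c)
          (complexBetti.map (AbelianVariety.snd A B).hom.hom.hom l w)) := by
  intro A B a b hA hB k l m hklm p q p' q' c w hc hw
  subst hA hB
  have hA' : IsSmoothProjective A.dim A.X := AbelianVariety.isSmoothProjective_holds
  have hB' : IsSmoothProjective B.dim B.X := AbelianVariety.isSmoothProjective_holds
  have hAB : IsSmoothProjective (A.dim + B.dim) (A.prod B).X := isSmoothProjective_prod hA' hB'
  have hI := hodgePQ_independent_of_hodgeModel_holds
  exact isOfHodgeType_cupProduct_map_fst_map_snd hklm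
    (preservesHodgeType_of_nonempty_hodgeModel hI nonempty_hodgeModel_holds hAB hA' _)
    (preservesHodgeType_of_nonempty_hodgeModel hI nonempty_hodgeModel_holds hAB hB' _)
    (cupPreservesHodgeType_of_nonempty_hodgeModel hI nonempty_hodgeModel_holds
      multiplicativeDeRham_complexModel hAB) hc hw

end Summit.HodgeConjecture.HodgeConjecture.Theorems.HeckePrymWeil

end
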